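import Literature.Barriers.CriticalPhenomena.LaceExpansionIsingGreenDecay
import Literature.Barriers.CriticalPhenomena.LaceExpansionIsingDeconvolutionProp12Lem51
import Literature.Probability.LatticeModels.LatticeGreenAsymptotics
import HarnessLib

/-!
# `LiuSlade2026_prop12_comparison_holds`: Liu–Slade's (1.9) for Sakai's spread-out walk, proved

Barrier catalogue `Literature/Barriers/CriticalPhenomena/` (D-0021). DISCHARGES the named fact
`SpreadOutIsing.LiuSlade2026_prop12_comparison` of `LaceExpansionIsingGreenDecay.lean` — Liu–Slade
2026, Proposition 1.2, first display (1.9): for `d > 2`, `ε > 0` there are `K`, `L₀` with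
`|S_1(x) - δ_{0,x} - C_1(x)/σ²| ≤ K/(L^{1-ε}⟦x⟧^{d-1})` for all `L ≥ L₀`, `x ∈ ℤ^d`, where
`S_1 = soGreen d L 1`, `σ² = soVariance d L` and `C_1 = d · latticeGreen` (the nearest-neighbour
Green function in the normalisation of `LatticeGreenFunction.lean`).

The same display is vendored a second time in the tree, over the SERIES `C_1 = Σ_n D_nn^{*n}`
(`srwGreen d`), as `LiuSlade2026_prop12_asymp` (`LaceExpansionIsingDeconvolutionParts.lean`), and that
version is now a theorem (`LiuSlade2026_prop12_asymp_holds`,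
`LaceExpansionIsingDeconvolutionProp12Lem51.lean`: Lemma 5.1 proved, assembled with the Fourier
representation and Lemma 3.1 by `LiuSlade2026_prop12_asymp_of_parts`). This file identifies the two
renderings of `C_1` — `srwGreen d x = d · latticeGreen x` (`srwGreen_eq_mul_latticeGreen`, from the
Fourier representation `srwGreen_eq_integral` of the series and the definition of `latticeGreen` as
the same integral) — and transports the theorem.

## `LiuSlade2026_nnGreenAsymptotics_holds` and `srwGreen_asymp_holds`: Liu–Slade's (1.8), proved

The second part of the file DISCHARGES the other named fact of `LaceExpansionIsingGreenDecay.lean`,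
`SpreadOutIsing.LiuSlade2026_nnGreenAsymptotics` — Liu–Slade 2026, §1.2.1 (1.8): "In the critical
case `μ = 1`, it is well-known (e.g., [LL10, Uchi98]) that `C_1(x) = a_d/⟦x⟧^{d-2} + O(1/⟦x⟧^d)`,
`a_d = dΓ((d-2)/2)/(2π^{d/2})` (`d > 2`)" (there with `C_1 = d · latticeGreen`, `⟦x⟧ = jnorm x`,
`a_d = gaussianAmp d`) — and, through `srwGreen_eq_mul_latticeGreen`, its twin over the series,
`SpreadOutIsing.srwGreen_asymp` of `LaceExpansionIsingDeconvolutionParts.lean`. Both follow from the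
tree's theorem `Literature.Probability.LatticeModels.latticeGreen_asymptotics`
(`LatticeGreenAsymptotics.lean`: for `d ≥ 3`,
`|latticeGreen x - Γ(d/2-1)/(2π^{d/2})|x|^{2-d}| ≤ K|x|^{-d}` for `x ≠ 0`, proved through the
heat-kernel representation `latticeGreen x = ∫₀^∞ ∏ᵢ q_t(xᵢ) dt`, the product structure of the
continuous-time simple random walk and a Gaussian-weighted local limit theorem for the
one-dimensional kernel `q_t` obtained by a contour shift — the local-limit-theorem route of
Lawler–Limic 2010, Thm. 4.3.1), multiplying by `d` and adjoining the single point `x = 0`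
(`⟦0⟧ = 1`). Consequence: the PRINTED route to (1.10),
`LiuSlade2026_prop12_greenBound_of_comparison : (1.8) → (1.9) → (1.10)`, is now hypothesis-free
(`LiuSlade2026_prop12_greenBound_of_nnGreenAsymptotics LiuSlade2026_nnGreenAsymptotics_holds`).

## References

* Y. Liu, G. Slade, *Gaussian deconvolution and the lace expansion for spread-out models*,
  Ann. Inst. H. Poincaré Probab. Statist. 62 (2026), arXiv:2310.07640: Proposition 1.2, (1.9);
  (1.7)–(1.8) (`C_1`, the nearest-neighbour Green function and its asymptotics) [LiuSlade2026].
* G. F. Lawler, V. Limic, *Random Walk: A Modern Introduction*, CUP 2010, Thm. 4.3.1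
  [LawlerLimic2010]; G. F. Lawler, *Intersections of Random Walks*, Birkhäuser 1991, Thm. 1.5.4
  [Lawler1991].
-/

noncomputable section

namespace Literature.Barriers.CriticalPhenomena.SpreadOutIsing

open _root_.MeasureTheory Literature.Probability.LatticeModels
open scoped BigOperators Real

variable {d : ℕ}

/-- **The two renderings of `C_1` agree**: `Σ_n D_nn^{*n}(x) = d · latticeGreen x` for `d ≥ 3`
(both equal `(2π)^{-d}∫_{[-π,π]^d} cos(k·x) (ε(k)/d)^{-1} dk`).
[cite: LiuSlade2026, (1.7)–(1.8) (C_1 as the Fourier integral of 1/(1 - D̂_nn))] -/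
theorem srwGreen_eq_mul_latticeGreen (hd : 3 ≤ d) (x : Site d) : srwGreen d x = d * latticeGreen x := by
  rw [srwGreen_eq_integral hd, latticeGreen]
  have h : ∀ k : Fin d → ℝ, (dispersion k / d)⁻¹ * Real.cos (kdot k x) =
      (d : ℝ) * (Real.cos (∑ i, k i * (x i : ℝ)) / dispersion k) := by
    intro k
    rw [inv_div, show kdot k x = ∑ i, k i * (x i : ℝ) from rfl]
    ring
  simp_rw [h]
  rw [integral_const_mul, show cube d = brillouin d from rfl]
  ring

/-- **Liu–Slade 2026, Proposition 1.2, (1.9), in the rendering of `LaceExpansionIsingGreenDecay.lean`,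
proved**: the named fact `LiuSlade2026_prop12_comparison` holds.
[cite: LiuSlade2026, Proposition 1.2, (1.9)] -/
theorem LiuSlade2026_prop12_comparison_holds : LiuSlade2026_prop12_comparison := by
  intro d hd ε hε
  obtain ⟨C, L₀, h⟩ := LiuSlade2026_prop12_asymp_holds d hd ε hε
  refine ⟨C, L₀, fun L hL x => ?_⟩
  have h' := h L hL x
  rwa [srwGreen_eq_mul_latticeGreen (by omega) x] at h'

/-- Hence Liu–Slade's bound (1.10) along its PRINTED route needs only (1.8):
`LiuSlade2026_nnGreenAsymptotics → LiuSlade2026_prop12_greenBound`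
(`LiuSlade2026_prop12_greenBound_of_comparison` with (1.9) discharged).
[cite: LiuSlade2026, Proposition 1.2, (1.9)–(1.10)] -/
theorem LiuSlade2026_prop12_greenBound_of_nnGreenAsymptotics (h8 : LiuSlade2026_nnGreenAsymptotics) :
    LiuSlade2026_prop12_greenBound :=
  LiuSlade2026_prop12_greenBound_of_comparison h8 LiuSlade2026_prop12_comparison_holds

/-! ## Liu–Slade's (1.8): the nearest-neighbour Green-function asymptotics, proved -/

/-- **Liu–Slade 2026, (1.8), proved** (Lawler–Limic 2010, Thm. 4.3.1; Lawler 1991, Thm. 1.5.4 with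
the `O(|x|^{-d})` remainder): for every `d > 2` there is `K` with
`|d · latticeGreen x - a_d/⟦x⟧^{d-2}| ≤ K/⟦x⟧^d` for all `x ∈ ℤ^d` — the named fact
`LiuSlade2026_nnGreenAsymptotics` holds. From `latticeGreen_asymptotics` (`x ≠ 0`, `⟦x⟧ = |x|`)
and the value at the origin (`⟦0⟧ = 1`).
[cite: LiuSlade2026, §1.2.1, (1.8)] [cite: LawlerLimic2010, Theorem 4.3.1]
[cite: Lawler1991, Theorem 1.5.4 and the remark following its proof] -/
theorem LiuSlade2026_nnGreenAsymptotics_holds : LiuSlade2026_nnGreenAsymptotics := by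
  intro d hd
  have hd3 : 3 ≤ d := hd
  have hd0 : (0 : ℝ) < d := by exact_mod_cast (show 0 < d by omega)
  obtain ⟨K, hK⟩ := latticeGreen_asymptotics hd3
  refine ⟨max ((d : ℝ) * K) (|(d : ℝ) * latticeGreen (0 : Site d) - gaussianAmp d|), fun x => ?_⟩
  by_cases hx : x = 0
  · -- the origin: `⟦0⟧ = 1`
    subst hx
    have h0 : jnorm (0 : Site d) = 1 := by
      unfold jnorm euclidNorm
      simp
    rw [h0, Real.one_rpow, Real.one_rpow, div_one, div_one]
    exact le_max_right _ _
  · -- `x ≠ 0`: `⟦x⟧ = |x| ≥ 1`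
    have h := hK x hx
    set r : ℝ := Real.sqrt (∑ i, ((x i : ℤ) : ℝ) ^ 2) with hr
    have hr1 : 1 ≤ r := one_le_sqrt_sum_sq_of_ne_zero hx
    have hr0 : 0 < r := by linarith
    have hj : jnorm x = r := by
      unfold jnorm euclidNorm
      rw [← hr]
      exact max_eq_left hr1
    rw [hj]
    have hrd : 0 < r ^ (d : ℝ) := Real.rpow_pos_of_pos hr0 _
    -- the main term: `a_d / r^{d-2} = d · (Γ(d/2-1)/(2π^{d/2})) · r^{2-d}`
    have hmain : gaussianAmp d / r ^ ((d : ℝ) - 2) =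
        (d : ℝ) * (Real.Gamma ((d : ℝ) / 2 - 1) / (2 * Real.pi ^ ((d : ℝ) / 2)) * r ^ (2 - (d : ℝ))) := by
      unfold gaussianAmp
      rw [show (2 : ℝ) - d = -((d : ℝ) - 2) by ring, Real.rpow_neg hr0.le]
      ring
    have herr : (d : ℝ) * K * r ^ (-(d : ℝ)) = (d : ℝ) * K / r ^ (d : ℝ) := by
      rw [Real.rpow_neg hr0.le]; ring
    rw [hmain, ← mul_sub, abs_mul, abs_of_pos hd0]
    calc (d : ℝ) * |latticeGreen x - Real.Gamma ((d : ℝ) / 2 - 1) / (2 * Real.pi ^ ((d : ℝ) / 2)) *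
          r ^ (2 - (d : ℝ))|
        ≤ (d : ℝ) * (K * r ^ (-(d : ℝ))) := mul_le_mul_of_nonneg_left h hd0.le
      _ = (d : ℝ) * K / r ^ (d : ℝ) := by rw [← herr]; ring
      _ ≤ max ((d : ℝ) * K) (|(d : ℝ) * latticeGreen (0 : Site d) - gaussianAmp d|) / r ^ (d : ℝ) :=
          div_le_div_of_nonneg_right (le_max_left _ _) hrd.le

/-- **The same asymptotics for the series rendering `C_1 = Σ_n D_nn^{*n}`, proved**: the named fact
`srwGreen_asymp` of `LaceExpansionIsingDeconvolutionParts.lean` (Liu–Slade 2026, (1.8); Liu–Slade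
2024, (1.6); Lawler 1991, Thm. 1.5.4) holds — `srwGreen d = d · latticeGreen`
(`srwGreen_eq_mul_latticeGreen`) and `LiuSlade2026_nnGreenAsymptotics_holds`.
[cite: LiuSlade2026, §1.2.1, (1.8)] [cite: Lawler1991, Theorem 1.5.4 and the remark following its proof] -/
theorem srwGreen_asymp_holds : srwGreen_asymp := by
  intro d hd
  obtain ⟨K, hK⟩ := LiuSlade2026_nnGreenAsymptotics_holds d hd
  refine ⟨K, fun x => ?_⟩
  rw [srwGreen_eq_mul_latticeGreen (by omega) x]
  exact hK x

end Literature.Barriers.CriticalPhenomena.SpreadOutIsing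

end
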